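import Literature.NumberTheory.GaloisRepresentations.LubinTateUnramifiedDisjoint
import Mathlib.FieldTheory.LinearDisjoint
import HarnessLib

/-!
# `E ∩ K_π^{n+1} = F` as a LATTICE statement, and the absolute value of the division points `λ_{n+1}`

Topic `NumberTheory/GaloisRepresentations`; namespace `Literature.NumberTheory.GaloisRepresentations`.
Theorems only (no definition, no named fact, no instance). Complement to `LubinTateUnramifiedDisjoint.lean`
(cf2c-w7 g4: `[E(λ_{n+1}) : E] = (q−1)qⁿ`, `[E·K_π^{n+1} : F] = [E:F]·[K_π^{n+1}:F]` for `E ⊆ F^{nr}` finite, Eisenstein over `𝒪_E`):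

* `linearDisjoint_ltField_of_le_maxUnramified`, ★ `inf_ltField_eq_bot_of_le_maxUnramified` (`E ⊓ K_π^{n+1} = ⊥`, the
  hypothesis `hdisj` of the relative character-cell files), `ltField_inf_eq_bot_of_le_maxUnramified` — from the degree
  product by Mathlib `IntermediateField.LinearDisjoint.of_finrank_sup` / `.inf_eq_bot`;
* `algNorm_eq_of_mem_rootSet_minpoly` (conjugate elements of `F̄` have the same absolute value),
  `algNorm_coeff_zero_eq_pow_of_forall_mem_roots`, ★ `algNorm_ltRoot_pow` (**`‖λ_{n+1}‖^{(q−1)qⁿ} = ‖π‖`**), `ltRoot_ne_zero`.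

## References
* [deShalit1987] E. de Shalit (1987), I §1.1, §2.2 (the towers `k'(W_f^n)` over an unramified `k'`).
* [SerreLocalFields1979] J.-P. Serre, *Local Fields*, Ch. II §2 Cor. 3 (conjugates have the same valuation), Ch. III §5.
* [CasselsFrohlichANT1967] Ch. VI §3.6 Prop. 6 and Cor., §3.7.
-/

noncomputable section

open ValuativeRel IsLocalRing Field Polynomial IntermediateField
open Literature.NumberTheory.GaloisRepresentations.IsNonarchimedeanLocalField

namespace Literature.NumberTheory.GaloisRepresentations

section Conjugates

variable {F : Type} [Field F] [ValuativeRel F] [TopologicalSpace F] [IsNonarchimedeanLocalField F]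

/-- **Conjugates have the same absolute value**: every `F̄`-root of the minimal polynomial of `x ∈ F̄` over `F` has the same
`algNorm` as `x` (it is `σ x` for some `σ ∈ Γ_F`). [cite: SerreLocalFields1979, Ch. II §2 Cor. 3 to Prop. 3] -/
theorem algNorm_eq_of_mem_rootSet_minpoly (x : AlgebraicClosure F) {y : AlgebraicClosure F}
    (hy : y ∈ (minpoly F x).rootSet (AlgebraicClosure F)) : algNorm F y = algNorm F x := by
  rw [← Algebra.IsAlgebraic.range_eval_eq_rootSet_minpoly (F := F) (K := AlgebraicClosure F)
    (AlgebraicClosure F) x] at hy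
  obtain ⟨ψ, rfl⟩ := hy
  set σ : absoluteGaloisGroup F := AlgEquiv.ofBijective ψ (Algebra.IsAlgebraic.algHom_bijective ψ) with hσ
  have h : ψ x = σ • x := rfl
  change algNorm F (ψ x) = algNorm F x
  rw [h, algNorm_smul]

/-- The absolute value of a product over a multiset is the product of the absolute values. [folklore] -/
private theorem algNorm_multiset_prod (s : Multiset (AlgebraicClosure F)) :
    algNorm F s.prod = (s.map (algNorm F)).prod := by
  induction s using Multiset.induction_on with
  | empty => simp
  | cons a s ih => rw [Multiset.prod_cons, algNorm_mul, ih, Multiset.map_cons, Multiset.prod_cons]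

/-- **The constant term of a monic polynomial over `F̄` all of whose roots have absolute value `r` has absolute value
`r^{deg}`.** [cite: SerreLocalFields1979, Ch. II §2 Cor. 3 to Prop. 3] -/
theorem algNorm_coeff_zero_eq_pow_of_forall_mem_roots {f : (AlgebraicClosure F)[X]} (hm : f.Monic) {r : ℝ}
    (hr : ∀ y ∈ f.roots, algNorm F y = r) : algNorm F (f.coeff 0) = r ^ f.natDegree := by
  have hf : f.Splits := IsAlgClosed.splits f
  rw [hf.coeff_zero_eq_prod_roots_of_monic hm, algNorm_mul, algNorm_pow, algNorm_neg, algNorm_one, one_pow, one_mul,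
    algNorm_multiset_prod, hf.natDegree_eq_card_roots]
  rw [Multiset.map_congr rfl hr, Multiset.map_const', Multiset.prod_replicate]

end Conjugates

section LinearDisjoint

variable {F : Type} [Field F] [ValuativeRel F] [TopologicalSpace F] [IsNonarchimedeanLocalField F]
variable {π : 𝒪[F]} (hπ : (valuation F).IsUniformizer (π : F)) (n : ℕ)
variable (E : IntermediateField F (AlgebraicClosure F)) [FiniteDimensional F E]

include hπ in
/-- `‖λ_{n+1}‖^{(q−1)qⁿ} = ‖π‖`: the `F̄`-roots of `φ_{n+1}` are conjugate to `λ_{n+1}` and their product is `±π`.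
[cite: CasselsFrohlichANT1967, Ch. VI §3.6 Prop. 6 (proof) and Cor.] -/
theorem algNorm_ltRoot_pow :
    algNorm F (ltRoot π n) ^ ((residueFieldCard F - 1) * residueFieldCard F ^ n) =
      algNorm F (algebraMap 𝒪[F] (AlgebraicClosure F) π) := by
  have hmF : (minpoly F (ltRoot π n)).Monic := minpoly.monic (isIntegral_ltRoot π n)
  have hpm : ((minpoly F (ltRoot π n)).map (algebraMap F (AlgebraicClosure F))).Monic := hmF.map _
  have hroots : ∀ y ∈ ((minpoly F (ltRoot π n)).map (algebraMap F (AlgebraicClosure F))).roots,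
      algNorm F y = algNorm F (ltRoot π n) := fun y hy ↦ by
    refine algNorm_eq_of_mem_rootSet_minpoly (ltRoot π n) ?_
    rw [Polynomial.mem_rootSet]
    exact ⟨minpoly.ne_zero (isIntegral_ltRoot π n), by
      rw [Polynomial.aeval_def, Polynomial.eval₂_eq_eval_map]
      exact (Polynomial.mem_roots hpm.ne_zero).mp hy⟩
  have h := algNorm_coeff_zero_eq_pow_of_forall_mem_roots hpm hroots
  rw [hmF.natDegree_map, Polynomial.coeff_map, minpoly_ltRoot π hπ n, (monic_ltPolyDiv π n).1.natDegree_map,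
    (monic_ltPolyDiv π n).2.1, Polynomial.coeff_map, (monic_ltPolyDiv π n).2.2] at h
  rw [IsScalarTower.algebraMap_apply 𝒪[F] F (AlgebraicClosure F), ← h]

include hπ in
/-- `λ_{n+1} ≠ 0` (`φ_{n+1}(0) = π ≠ 0`). [cite: CasselsFrohlichANT1967, Ch. VI §3.6 Prop. 6 (proof)] -/
theorem ltRoot_ne_zero : ltRoot π n ≠ 0 := by
  intro h0
  have h := (minpoly.coeff_zero_eq_zero (isIntegral_ltRoot π n)).mpr h0
  rw [minpoly_ltRoot π hπ n, Polynomial.coeff_map, (monic_ltPolyDiv π n).2.2] at h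
  exact hπ.ne_zero h

include hπ in
/-- **`E` and `K_π^{n+1}` are linearly disjoint over `F`** for `E ⊆ F^{nr}` finite (degree product, `LubinTateUnramifiedDisjoint`).
[cite: deShalit1987, I §2.2] [cite: CasselsFrohlichANT1967, Ch. VI §3.7] -/
theorem linearDisjoint_ltField_of_le_maxUnramified (hE : E ≤ maxUnramified F) : E.LinearDisjoint (ltField π n) :=
  IntermediateField.LinearDisjoint.of_finrank_sup (finrank_sup_ltField_of_le_maxUnramified hπ E hE n)

include hπ in
/-- ★ **`E ∩ K_π^{n+1} = F`** for `E ⊆ F^{nr}` finite: an unramified and a totally ramified (Lubin–Tate) extension meet in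
the base. [cite: deShalit1987, I §1.1 and §2.2] [cite: SerreLocalFields1979, Ch. III §5] -/
theorem inf_ltField_eq_bot_of_le_maxUnramified (hE : E ≤ maxUnramified F) : E ⊓ ltField π n = ⊥ :=
  (linearDisjoint_ltField_of_le_maxUnramified hπ n E hE).inf_eq_bot

include hπ in
/-- `K_π^{n+1} ∩ E = F` (symmetric form). [cite: deShalit1987, I §1.1 and §2.2] -/
theorem ltField_inf_eq_bot_of_le_maxUnramified (hE : E ≤ maxUnramified F) : ltField π n ⊓ E = ⊥ := by
  rw [inf_comm]; exact inf_ltField_eq_bot_of_le_maxUnramified hπ n E hE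

end LinearDisjoint

end Literature.NumberTheory.GaloisRepresentations

end
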